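import Summits.QuantumFields.YangMills.Theorems.LuscherReductionTwistedTraceScalingElectricSplit
import Summits.QuantumFields.YangMills.Theorems.LuscherReductionTwistedTraceScalingMagneticLattice
import HarnessLib

/-!
# The kinetic factor of the `L³` transfer kernel in the tangent chart: an exact formula and a two-sided Gaussian SANDWICH in the colour-vector
# coordinates — `e^{2β|E|}·e^{−β(1+4ρ)‖v−v'‖²} ≤ latE ≤ e^{2β|E|}·e^{−β‖v−v'‖²}` near the vacuum
# (lane B of S-BASE, crux `TwistedTraceScaling` stmt-QuantumFields-20203; both COARSE lanes)

`latE = e^{2β|E|}·exp(−(β/2)Σ_e‖U_e − V_e‖_F²)` (`…ElectricSplit.latE_eq_exp_frobSq`) and `‖U − V‖_F² = 2((s_U−s_V)² + |v_U−v_V|²)`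
(`…TangentChart.frobNorm_sub_sq_eq`) give the EXACT chart form `latE = e^{2β|E|}·e^{−β‖v−v'‖²}·e^{−βΣ_e(s_e−s'_e)²}` with `v = linkVec U`,
`v' = linkVec V ∈ LinkSpace L` (`latE_eq_chart`).  Since `0 ≤ (s_e − s'_e)² ≤ 4(|v_e|²+|v'_e|²)|v_e − v'_e|²` for `s_e, s'_e ≥ ½`
(`…TangentChart.scalarPart_sub_sq_le`), the kinetic factor is sandwiched between two Gaussians of `LinkSpace L` whose exponents differ by the
relative amount `4ρ`, `ρ = max_e (|v_e|² + |v'_e|²)` (`latE_le_chartGauss`, `chartGauss_le_latE`): on the Gaussian bulk `|v| ≲ β^{−1/2+δ}` this is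
the `o(1)` relative control of the kinetic exponent needed by the sub/supersolution estimates, to be combined with
`…MagneticLattice.abs_wilsonAction_sub_inner_stiffHessian_le` (magnetic factor) and `…StiffHessian.stiff_groundState` (the harmonic model).
HONEST FRAMING: exact algebra + one elementary inequality; no measure, no asymptotics; femto rung R2b1 (stub of a child of a CONDITIONAL route);
not a gap, not Clay.
-/

set_option autoImplicit false

noncomputable section

open scoped Matrix ComplexConjugate BigOperators RealInnerProductSpace
open Literature.MathematicalPhysics.QuantumFieldTheory
open Literature.MathematicalPhysics.QuantumLattice

namespace Summit.QuantumFields.YangMills.Theorems.FemtoTransferGap.TwoLattice.Stiff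

open Summit.QuantumFields.YangMills.Theorems.FemtoTransferGap
open Summit.QuantumFields.YangMills.Theorems.FemtoTransferGap.TwoLattice

variable {L : ℕ} [NeZero L]

/-- `‖linkVec U − linkVec V‖² = Σ_e Σ_a (v_e(U) − v_e(V))_a²`. [folklore] -/
theorem norm_linkVec_sub_sq (U V : GaugeConfig 3 L SU2) :
    ‖linkVec L U - linkVec L V‖ ^ 2 = ∑ e : Edge 3 L, ∑ a : Fin 3, (vecPart (U e) a - vecPart (V e) a) ^ 2 := by
  rw [EuclideanSpace.norm_sq_eq, Fintype.sum_prod_type]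
  refine Finset.sum_congr rfl fun e _ => Finset.sum_congr rfl fun a _ => ?_
  rw [Real.norm_eq_abs, sq_abs]
  rfl

/-- ★ **Exact chart form of the kinetic factor**:
`latE L β U V = e^{2β|E|} · exp(−β‖linkVec U − linkVec V‖²) · exp(−β Σ_e (s_e(U) − s_e(V))²)`. [cite: MontvayMunster1994, §3.2.3 (3.97)] -/
theorem latE_eq_chart (β : ℝ) (U V : GaugeConfig 3 L SU2) :
    latE L β U V = Real.exp (2 * β) ^ Fintype.card (Edge 3 L) *
      Real.exp (-(β * ‖linkVec L U - linkVec L V‖ ^ 2)) *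
        Real.exp (-(β * ∑ e : Edge 3 L, (scalarPart (U e) - scalarPart (V e)) ^ 2)) := by
  rw [Electric.latE_eq_exp_frobSq, norm_linkVec_sub_sq, mul_assoc, ← Real.exp_add]
  congr 2
  simp_rw [Chart.frobNorm_sub_sq_eq]
  rw [Finset.mul_sum, Finset.mul_sum, Finset.mul_sum, ← Finset.sum_neg_distrib, ← Finset.sum_neg_distrib, ← Finset.sum_neg_distrib,
    ← Finset.sum_add_distrib]
  exact Finset.sum_congr rfl fun e _ => by ring

/-- ★ **Upper Gaussian**: `latE ≤ e^{2β|E|}·e^{−β‖v − v'‖²}` (`β ≥ 0`; the scalar factor is `≤ 1`). [folklore] -/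
theorem latE_le_chartGauss {β : ℝ} (hβ : 0 ≤ β) (U V : GaugeConfig 3 L SU2) :
    latE L β U V ≤ Real.exp (2 * β) ^ Fintype.card (Edge 3 L) * Real.exp (-(β * ‖linkVec L U - linkVec L V‖ ^ 2)) := by
  rw [latE_eq_chart]
  have h : Real.exp (-(β * ∑ e : Edge 3 L, (scalarPart (U e) - scalarPart (V e)) ^ 2)) ≤ 1 := by
    rw [Real.exp_le_one_iff, neg_nonpos]
    exact mul_nonneg hβ (Finset.sum_nonneg fun e _ => sq_nonneg _)
  calc Real.exp (2 * β) ^ Fintype.card (Edge 3 L) * Real.exp (-(β * ‖linkVec L U - linkVec L V‖ ^ 2)) *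
        Real.exp (-(β * ∑ e : Edge 3 L, (scalarPart (U e) - scalarPart (V e)) ^ 2))
      ≤ Real.exp (2 * β) ^ Fintype.card (Edge 3 L) * Real.exp (-(β * ‖linkVec L U - linkVec L V‖ ^ 2)) * 1 :=
        mul_le_mul_of_nonneg_left h (by positivity)
    _ = _ := mul_one _

/-- ★ **Lower Gaussian**: if every link of `U` and `V` has scalar part `≥ ½` and `|v_e(U)|² + |v_e(V)|² ≤ ρ` for every link, then
`e^{2β|E|}·e^{−β(1+4ρ)‖v − v'‖²} ≤ latE` (`β ≥ 0`). [folklore] -/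
theorem chartGauss_le_latE {β : ℝ} (hβ : 0 ≤ β) (U V : GaugeConfig 3 L SU2) (hU : ∀ e, 1 / 2 ≤ scalarPart (U e))
    (hV : ∀ e, 1 / 2 ≤ scalarPart (V e)) {ρ : ℝ}
    (hρ : ∀ e, (∑ a, vecPart (U e) a ^ 2) + ∑ a, vecPart (V e) a ^ 2 ≤ ρ) :
    Real.exp (2 * β) ^ Fintype.card (Edge 3 L) * Real.exp (-(β * (1 + 4 * ρ) * ‖linkVec L U - linkVec L V‖ ^ 2)) ≤ latE L β U V := by
  rw [latE_eq_chart, mul_assoc (Real.exp (2 * β) ^ Fintype.card (Edge 3 L)), ← Real.exp_add]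
  refine mul_le_mul_of_nonneg_left (Real.exp_le_exp.2 ?_) (by positivity)
  -- `Σ_e (Δs_e)² ≤ 4ρ · ‖Δv‖²`
  have hs : ∑ e : Edge 3 L, (scalarPart (U e) - scalarPart (V e)) ^ 2 ≤ 4 * ρ * ‖linkVec L U - linkVec L V‖ ^ 2 := by
    rw [norm_linkVec_sub_sq, Finset.mul_sum]
    refine Finset.sum_le_sum fun e _ => ?_
    have h1 := Chart.scalarPart_sub_sq_le (U e) (V e) (hU e) (hV e)
    have h0 : 0 ≤ ∑ a, (vecPart (U e) a - vecPart (V e) a) ^ 2 := Finset.sum_nonneg fun a _ => sq_nonneg _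
    calc (scalarPart (U e) - scalarPart (V e)) ^ 2
        ≤ 4 * ((∑ a, vecPart (U e) a ^ 2) + ∑ a, vecPart (V e) a ^ 2) * ∑ a, (vecPart (U e) a - vecPart (V e) a) ^ 2 := h1
      _ ≤ 4 * ρ * ∑ a, (vecPart (U e) a - vecPart (V e) a) ^ 2 :=
          mul_le_mul_of_nonneg_right (mul_le_mul_of_nonneg_left (hρ e) (by norm_num)) h0
  have h2 : β * ∑ e : Edge 3 L, (scalarPart (U e) - scalarPart (V e)) ^ 2 ≤ β * (4 * ρ * ‖linkVec L U - linkVec L V‖ ^ 2) :=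
    mul_le_mul_of_nonneg_left hs hβ
  nlinarith

/-- In the hemisphere `s ≥ ½` is implied by `‖U − 1‖_F² ≤ 2` (`‖U − 1‖_F² = 4(1 − s)`). [folklore] -/
theorem half_le_scalarPart_of_frobNorm_sq_le (W : SU2) (h : frobNorm ((W : Matrix (Fin 2) (Fin 2) ℂ) - 1) ^ 2 ≤ 2) :
    1 / 2 ≤ scalarPart W := by
  rw [frobNorm_sub_one_sq_eq_scalarPart] at h; linarith

/-- ★ **The sandwich on the Frobenius ball** `‖U_e − 1‖_F, ‖V_e − 1‖_F ≤ r ≤ 1`: with `v = linkVec U`, `v' = linkVec V`,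
`e^{2β|E|}·e^{−β(1+4r²)‖v−v'‖²} ≤ latE ≤ e^{2β|E|}·e^{−β‖v−v'‖²}` (`|v_e|² ≤ ‖U_e−1‖_F²/2 ≤ r²/2` per link). [folklore] -/
theorem latE_chart_sandwich {β : ℝ} (hβ : 0 ≤ β) (U V : GaugeConfig 3 L SU2) {r : ℝ} (hr1 : r ≤ 1)
    (hrU : ∀ e, frobNorm ((U e : Matrix (Fin 2) (Fin 2) ℂ) - 1) ≤ r) (hrV : ∀ e, frobNorm ((V e : Matrix (Fin 2) (Fin 2) ℂ) - 1) ≤ r) :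
    Real.exp (2 * β) ^ Fintype.card (Edge 3 L) * Real.exp (-(β * (1 + 4 * r ^ 2) * ‖linkVec L U - linkVec L V‖ ^ 2)) ≤ latE L β U V ∧
      latE L β U V ≤ Real.exp (2 * β) ^ Fintype.card (Edge 3 L) * Real.exp (-(β * ‖linkVec L U - linkVec L V‖ ^ 2)) := by
  have hsq : ∀ {W : SU2}, frobNorm ((W : Matrix (Fin 2) (Fin 2) ℂ) - 1) ≤ r → frobNorm ((W : Matrix (Fin 2) (Fin 2) ℂ) - 1) ^ 2 ≤ r ^ 2 :=
    fun h => pow_le_pow_left₀ (frobNorm_nonneg _) h 2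
  have hr2 : r ^ 2 ≤ 1 := by
    have hr0 : 0 ≤ r := (frobNorm_nonneg _).trans (hrU ((0 : Site 3 L), (0 : Fin 3)))
    nlinarith
  have hU : ∀ e, 1 / 2 ≤ scalarPart (U e) := fun e => half_le_scalarPart_of_frobNorm_sq_le _ ((hsq (hrU e)).trans (by linarith))
  have hV : ∀ e, 1 / 2 ≤ scalarPart (V e) := fun e => half_le_scalarPart_of_frobNorm_sq_le _ ((hsq (hrV e)).trans (by linarith))
  have hρ : ∀ e, (∑ a, vecPart (U e) a ^ 2) + ∑ a, vecPart (V e) a ^ 2 ≤ r ^ 2 := fun e => by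
    have h1 := sum_vecPart_sq_le_frobNorm_sub_one_sq (U e)
    have h2 := sum_vecPart_sq_le_frobNorm_sub_one_sq (V e)
    have := hsq (hrU e); have := hsq (hrV e); linarith
  exact ⟨chartGauss_le_latE hβ U V hU hV hρ, latE_le_chartGauss hβ U V⟩

end Summit.QuantumFields.YangMills.Theorems.FemtoTransferGap.TwoLattice.Stiff

end
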